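import Summits.CriticalPhenomena.PercolationContinuityZ3.Theorems.PercNearOneGluingNoHeavyQuantFarTwoTerminalReachOut
import Summits.CriticalPhenomena.PercolationContinuityZ3.Theorems.PercNearOneGluingNoHeavyQuantFarTwoTerminalExit
import HarnessLib

/-!
# QUANT lane R8, front "FAR beyond trees", layer one — TWO-TERMINAL BLOCKS III: the law decomposition `P(N ≤ 1) = Σ (outside cell) × (inside event)`

builds on p205010 (kernel theorem, internal audit signed; external expert review pending)

Support file (`--supports stmt-CriticalPhenomena-4575`), seat `prim-quant-p1` (gen 25); memo
`run/shared/lean/prim/quant/prim-quant-p1-g25/FOR-LEAD-TWOTERMINAL.md` §2, §8(a).  Standard axioms; no sorries; no definitions.  Two-terminal analogue of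
`Block.real_two_le_card_eq` (`…QuantFarBlockLaw`, one cut vertex): the exact bilinear form that the two-terminal LP (memo §4) optimises.

Block `Z` at terminals `c₁, c₂` (`o ∉ Z`, weights vanishing between `Z` and `(Z ∪ {c₁,c₂})ᶜ`).  OUTSIDE data (read off `offZ Z`): the gates `G_i = {o ~ c_i off Z}`,
`K_off = #{x ∈ A ∖ Z : o ~ x off Z}`, and the FEEDBACK counts `K'_{j} = #{x ∈ A ∖ Z : ¬ o ~ x off Z ∧ c_j ~ x off Z}`; INSIDE data (read off `onZ Z`):
`I = [c₁ ~ c₂ on Z]`, `X_i = #{a ∈ A ∩ Z : c_i ~ a on Z}`, `X₁₂ = #{a ∈ A ∩ Z : c₁ ~ a ∨ c₂ ~ a on Z}`.  On good configurations (`…TwoTerminalReach/ReachOut`)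
`N = K_off` if no gate, `N = K_off + X_i + I·K'_j` if only gate `i` (`j ≠ i`), `N = K_off + X₁₂` if both gates.  Hence, by independence of the two coordinate sets:
* `Block.card_filter_sdiff_eq₂_of_none/of_one/of_both` — the three count identities for the outside relays;
* `Block.real_card_le_one_inter_none_eq`, `Block.real_card_le_one_inter_one_eq` (general gate `c`, idle gate `c'`: FIVE products),
  `Block.real_card_le_one_inter_both_eq` (two products);
* **`Block.real_card_le_one_eq₂`** — `P(N ≤ 1)` = the sum of the `1 + 5 + 5 + 2` products over the outside cells
  `{type} × {K_off ∈ {0,1}} × {K' ∈ {0, 1, ≥2}}` with the inside events `{X ≤ 1}`, `{X = 0 ∨ (X = 1 ∧ ¬I)}`, `{X ≤ 1 ∧ ¬I}`, `{X = 0}`, `{X = 0 ∧ ¬I}`, `{X₁₂ ≤ 1}`, `{X₁₂ = 0}`.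
[cite: Grimmett1999, §1.3 p. 10; §2.2] (product measure; events determined by finitely many coordinates); bookkeeping [this work].
-/

noncomputable section

namespace Summit.CriticalPhenomena.PercolationContinuityZ3.Theorems

namespace Quant

namespace Block

open Finset MeasureTheory Set
open Literature.Probability.LatticeModels
open Literature.Probability.Percolation
open Bundle (offZ avoid offZ_eq_inter determinedBy_offZ reachable_of_offZ)
open scoped Classical

variable {n : ℕ}

section Count

variable {o c₁ c₂ : Fin n} {Z : Finset (Fin n)}

/-- **Outside relays, no gate**: if neither terminal is joined to `o` off `Z`, the outside relays reached are those reached off `Z`. [this work] -/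
theorem card_filter_sdiff_eq₂_of_none {ω : BondConfig (Fin n)}
    (hω : ∀ x y : Fin n, x ≠ y → s(x, y) ∈ ω → x ∈ Z → y ∉ Z → y = c₁ ∨ y = c₂) (ho : o ∉ Z)
    (h₁ : ¬ (openGraph (offZ Z ω)).Reachable o c₁) (h₂ : ¬ (openGraph (offZ Z ω)).Reachable o c₂) (A : Finset (Fin n)) :
    ((A \ Z).filter fun x => ω ∈ openConn o x).card = ((A \ Z).filter fun x => offZ Z ω ∈ openConn o x).card := by
  refine congrArg _ (filter_congr fun x hx => ?_)
  rw [show (ω ∈ openConn o x) = (openGraph ω).Reachable o x from rfl, reach_off₂_iff hω ho (mem_sdiff.1 hx).2]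
  exact ⟨fun h => h.elim id fun h => h.2.elim (fun h' => absurd h'.1 h₁) fun h' => absurd h'.1 h₂, Or.inl⟩

/-- **Outside relays, both gates**: if both terminals are joined to `o` off `Z`, the outside relays reached are those reached off `Z`. [this work] -/
theorem card_filter_sdiff_eq₂_of_both {ω : BondConfig (Fin n)}
    (hω : ∀ x y : Fin n, x ≠ y → s(x, y) ∈ ω → x ∈ Z → y ∉ Z → y = c₁ ∨ y = c₂) (ho : o ∉ Z)
    (h₁ : (openGraph (offZ Z ω)).Reachable o c₁) (h₂ : (openGraph (offZ Z ω)).Reachable o c₂) (A : Finset (Fin n)) :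
    ((A \ Z).filter fun x => ω ∈ openConn o x).card = ((A \ Z).filter fun x => offZ Z ω ∈ openConn o x).card := by
  refine congrArg _ (filter_congr fun x hx => ?_)
  rw [show (ω ∈ openConn o x) = (openGraph ω).Reachable o x from rfl, reach_off₂_iff hω ho (mem_sdiff.1 hx).2]
  refine ⟨fun h => h.elim id fun h => h.2.elim (fun h' => h₂.trans h'.2) fun h' => h₁.trans h'.2, Or.inl⟩

/-- **Outside relays, one gate** (general gate `c`, idle gate `c'`, `{c, c'} = {c₁, c₂}`): if `o ~ c off Z` and not `o ~ c' off Z`, the outside relays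
reached are those reached off `Z`, plus — when the block is crossed — those hanging at `c'`:
`#{x ∈ A∖Z : o ↔ x} = K_off + (if c₁ ~ c₂ on Z then #{x ∈ A∖Z : ¬ o ~ x off Z ∧ c' ~ x off Z} else 0)`. [this work] -/
theorem card_filter_sdiff_eq₂_of_one {ω : BondConfig (Fin n)} {c c' : Fin n} (hcc' : (c = c₁ ∧ c' = c₂) ∨ (c = c₂ ∧ c' = c₁))
    (hω : ∀ x y : Fin n, x ≠ y → s(x, y) ∈ ω → x ∈ Z → y ∉ Z → y = c₁ ∨ y = c₂) (ho : o ∉ Z)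
    (hc : (openGraph (offZ Z ω)).Reachable o c) (hc' : ¬ (openGraph (offZ Z ω)).Reachable o c') (A : Finset (Fin n)) :
    ((A \ Z).filter fun x => ω ∈ openConn o x).card =
      ((A \ Z).filter fun x => offZ Z ω ∈ openConn o x).card +
        (if onZ Z ω ∈ openConn c₁ c₂ then ((A \ Z).filter fun x => offZ Z ω ∉ openConn o x ∧ offZ Z ω ∈ openConn c' x).card else 0) := by
  -- pointwise: `o ↔ x ⟺ o ~ x off Z ∨ (I ∧ c' ~ x off Z)`
  have key : ∀ x ∈ A \ Z, (ω ∈ openConn o x ↔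
      offZ Z ω ∈ openConn o x ∨ (onZ Z ω ∈ openConn c₁ c₂ ∧ offZ Z ω ∉ openConn o x ∧ offZ Z ω ∈ openConn c' x)) := by
    intro x hx
    rw [show (ω ∈ openConn o x) = (openGraph ω).Reachable o x from rfl, reach_off₂_iff hω ho (mem_sdiff.1 hx).2]
    constructor
    · rintro (h | ⟨hI, h⟩)
      · exact Or.inl h
      · by_cases hox : (openGraph (offZ Z ω)).Reachable o x
        · exact Or.inl hox
        · right
          refine ⟨hI, hox, ?_⟩
          rcases hcc' with ⟨rfl, rfl⟩ | ⟨rfl, rfl⟩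
          · rcases h with ⟨-, h⟩ | ⟨h, -⟩
            · exact h
            · exact absurd h hc'
          · rcases h with ⟨h, -⟩ | ⟨-, h⟩
            · exact absurd h hc'
            · exact h
    · rintro (h | ⟨hI, -, h⟩)
      · exact Or.inl h
      · right
        refine ⟨hI, ?_⟩
        rcases hcc' with ⟨rfl, rfl⟩ | ⟨rfl, rfl⟩
        · exact Or.inl ⟨hc, h⟩
        · exact Or.inr ⟨hc, h⟩
  by_cases hI : onZ Z ω ∈ openConn c₁ c₂
  · rw [if_pos hI]
    have hsplit : ((A \ Z).filter fun x => ω ∈ openConn o x) =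
        ((A \ Z).filter fun x => offZ Z ω ∈ openConn o x) ∪
          ((A \ Z).filter fun x => offZ Z ω ∉ openConn o x ∧ offZ Z ω ∈ openConn c' x) := by
      rw [← filter_or]
      exact filter_congr fun x hx => by rw [key x hx]; simp only [hI, true_and]
    rw [hsplit, card_union_of_disjoint]
    exact disjoint_filter.2 fun x _ h h' => h'.1 h
  · rw [if_neg hI, add_zero]
    exact congrArg _ (filter_congr fun x hx => by rw [key x hx]; simp only [hI, false_and, or_false])

end Count

section Law

variable {o c₁ c₂ : Fin n} {Z : Finset (Fin n)}

/-- `P(N ≤ 1, no gate) = P(no gate, K_off ≤ 1)`. [this work] -/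
theorem real_card_le_one_inter_none_eq (v : Sym2 (Fin n) → unitInterval) (ho : o ∉ Z)
    (hv : ∀ x y : Fin n, x ≠ y → x ∈ Z → y ∉ Z → y ≠ c₁ → y ≠ c₂ → (v s(x, y) : ℝ) = 0) (A : Finset (Fin n)) :
    (prodBernoulli v).real ({ω : BondConfig (Fin n) | (A.filter fun x => ω ∈ openConn o x).card ≤ 1} ∩
        {ω | offZ Z ω ∉ openConn o c₁ ∧ offZ Z ω ∉ openConn o c₂}) =
      (prodBernoulli v).real {ω | (offZ Z ω ∉ openConn o c₁ ∧ offZ Z ω ∉ openConn o c₂) ∧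
        ((A \ Z).filter fun x => offZ Z ω ∈ openConn o x).card ≤ 1} := by
  refine real_congr_of_twoTerminal (c₁ := c₁) (c₂ := c₂) (Z := Z) v hv _ _ fun ω hω => ?_
  simp only [Set.mem_inter_iff, mem_setOf_eq]
  constructor
  · rintro ⟨hN, h₁, h₂⟩
    refine ⟨⟨h₁, h₂⟩, ?_⟩
    have h₁' : ¬ (openGraph (offZ Z ω)).Reachable o c₁ := h₁
    have h₂' : ¬ (openGraph (offZ Z ω)).Reachable o c₂ := h₂
    rw [card_filter_eq_sdiff_add_inter (Z := Z), card_filter_sdiff_eq₂_of_none hω ho h₁ h₂, card_filter_inter_eq₂ hω ho,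
      if_neg h₁', if_neg h₂', add_zero] at hN
    exact hN
  · rintro ⟨⟨h₁, h₂⟩, hK⟩
    refine ⟨?_, h₁, h₂⟩
    have h₁' : ¬ (openGraph (offZ Z ω)).Reachable o c₁ := h₁
    have h₂' : ¬ (openGraph (offZ Z ω)).Reachable o c₂ := h₂
    rw [card_filter_eq_sdiff_add_inter (Z := Z), card_filter_sdiff_eq₂_of_none hω ho h₁ h₂, card_filter_inter_eq₂ hω ho,
      if_neg h₁', if_neg h₂', add_zero]
    exact hK

/-- `P(N ≤ 1, both gates) = P(both, K_off = 0)·P(X₁₂ ≤ 1) + P(both, K_off = 1)·P(X₁₂ = 0)`. [this work] -/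
theorem real_card_le_one_inter_both_eq (v : Sym2 (Fin n) → unitInterval) (ho : o ∉ Z)
    (hv : ∀ x y : Fin n, x ≠ y → x ∈ Z → y ∉ Z → y ≠ c₁ → y ≠ c₂ → (v s(x, y) : ℝ) = 0) (A : Finset (Fin n)) :
    (prodBernoulli v).real ({ω : BondConfig (Fin n) | (A.filter fun x => ω ∈ openConn o x).card ≤ 1} ∩
        {ω | offZ Z ω ∈ openConn o c₁ ∧ offZ Z ω ∈ openConn o c₂}) =
      (prodBernoulli v).real {ω | (offZ Z ω ∈ openConn o c₁ ∧ offZ Z ω ∈ openConn o c₂) ∧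
          ((A \ Z).filter fun x => offZ Z ω ∈ openConn o x).card = 0} *
        (prodBernoulli v).real {ω | ((A ∩ Z).filter fun a => onZ Z ω ∈ openConn c₁ a ∨ onZ Z ω ∈ openConn c₂ a).card ≤ 1} +
      (prodBernoulli v).real {ω | (offZ Z ω ∈ openConn o c₁ ∧ offZ Z ω ∈ openConn o c₂) ∧
          ((A \ Z).filter fun x => offZ Z ω ∈ openConn o x).card = 1} *
        (prodBernoulli v).real {ω | ((A ∩ Z).filter fun a => onZ Z ω ∈ openConn c₁ a ∨ onZ Z ω ∈ openConn c₂ a).card = 0} := by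
  set μ := prodBernoulli v with hμ
  have hmeas : ∀ U : Set (BondConfig (Fin n)), MeasurableSet U := fun U => (Set.toFinite U).measurableSet
  set O0 := {ω : BondConfig (Fin n) | (offZ Z ω ∈ openConn o c₁ ∧ offZ Z ω ∈ openConn o c₂) ∧
    ((A \ Z).filter fun x => offZ Z ω ∈ openConn o x).card = 0} with hO0
  set O1 := {ω : BondConfig (Fin n) | (offZ Z ω ∈ openConn o c₁ ∧ offZ Z ω ∈ openConn o c₂) ∧
    ((A \ Z).filter fun x => offZ Z ω ∈ openConn o x).card = 1} with hO1
  set Y1 := {ω : BondConfig (Fin n) | ((A ∩ Z).filter fun a => onZ Z ω ∈ openConn c₁ a ∨ onZ Z ω ∈ openConn c₂ a).card ≤ 1} with hY1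
  set Y0 := {ω : BondConfig (Fin n) | ((A ∩ Z).filter fun a => onZ Z ω ∈ openConn c₁ a ∨ onZ Z ω ∈ openConn c₂ a).card = 0} with hY0
  have hST : μ.real ({ω : BondConfig (Fin n) | (A.filter fun x => ω ∈ openConn o x).card ≤ 1} ∩
      {ω | offZ Z ω ∈ openConn o c₁ ∧ offZ Z ω ∈ openConn o c₂}) = μ.real (O0 ∩ Y1 ∪ O1 ∩ Y0) := by
    refine real_congr_of_twoTerminal (c₁ := c₁) (c₂ := c₂) (Z := Z) v hv _ _ fun ω hω => ?_
    simp only [hO0, hO1, hY1, hY0, Set.mem_inter_iff, Set.mem_union, mem_setOf_eq]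
    constructor
    · rintro ⟨hN, h₁, h₂⟩
      have h₁' : (openGraph (offZ Z ω)).Reachable o c₁ := h₁
      have h₂' : (openGraph (offZ Z ω)).Reachable o c₂ := h₂
      rw [card_filter_eq_sdiff_add_inter (Z := Z), card_filter_sdiff_eq₂_of_both hω ho h₁ h₂, card_filter_inter_eq₂ hω ho,
        if_pos h₁', if_pos h₂'] at hN
      by_cases h0 : ((A \ Z).filter fun x => offZ Z ω ∈ openConn o x).card = 0
      · left; exact ⟨⟨⟨h₁, h₂⟩, h0⟩, by omega⟩
      · right; exact ⟨⟨⟨h₁, h₂⟩, by omega⟩, by omega⟩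
    · rintro (⟨⟨⟨h₁, h₂⟩, h0⟩, hY⟩ | ⟨⟨⟨h₁, h₂⟩, h0⟩, hY⟩) <;>
        refine ⟨?_, h₁, h₂⟩ <;>
        rw [card_filter_eq_sdiff_add_inter (Z := Z), card_filter_sdiff_eq₂_of_both hω ho h₁ h₂, card_filter_inter_eq₂ hω ho,
          if_pos (show (openGraph (offZ Z ω)).Reachable o c₁ from h₁), if_pos (show (openGraph (offZ Z ω)).Reachable o c₂ from h₂)] <;>
        omega
  have hd : Disjoint (O0 ∩ Y1) (O1 ∩ Y0) := by
    rw [Set.disjoint_left]; rintro ω ⟨⟨-, h0⟩, -⟩ ⟨⟨-, h1⟩, -⟩; omega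
  have hdO0 : DeterminedBy O0 (↑(avoid Z) : Set (Sym2 (Fin n))) := determinedBy_offZ Z fun η =>
    (η ∈ openConn o c₁ ∧ η ∈ openConn o c₂) ∧ ((A \ Z).filter fun x => η ∈ openConn o x).card = 0
  have hdO1 : DeterminedBy O1 (↑(avoid Z) : Set (Sym2 (Fin n))) := determinedBy_offZ Z fun η =>
    (η ∈ openConn o c₁ ∧ η ∈ openConn o c₂) ∧ ((A \ Z).filter fun x => η ∈ openConn o x).card = 1
  have hdY1 : DeterminedBy Y1 (↑(avoid Z) : Set (Sym2 (Fin n)))ᶜ := determinedBy_onZ Z fun η =>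
    ((A ∩ Z).filter fun a => η ∈ openConn c₁ a ∨ η ∈ openConn c₂ a).card ≤ 1
  have hdY0 : DeterminedBy Y0 (↑(avoid Z) : Set (Sym2 (Fin n)))ᶜ := determinedBy_onZ Z fun η =>
    ((A ∩ Z).filter fun a => η ∈ openConn c₁ a ∨ η ∈ openConn c₂ a).card = 0
  rw [hST, measureReal_union hd (hmeas _), prodBernoulli_real_inter_of_determinedBy v (avoid Z) hdO0 hdY1 (hmeas _) (hmeas _),
    prodBernoulli_real_inter_of_determinedBy v (avoid Z) hdO1 hdY0 (hmeas _) (hmeas _)]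

/-- **`P(N ≤ 1, one gate)`** for the gate `c` and the idle terminal `c'` (`{c, c'} = {c₁, c₂}`): with the outside cells
`O(k, J) = {o ~ c off Z, ¬ o ~ c' off Z, K_off = k, K' ∈ J}` (`K' = #{x ∈ A∖Z : ¬ o ~ x off Z ∧ c' ~ x off Z}`) and the inside events for
`X = #{a ∈ A ∩ Z : c ~ a on Z}`, `I = [c₁ ~ c₂ on Z]`:
`P = P(O(0,{0}))·P(X ≤ 1) + P(O(0,{1}))·P(X = 0 ∨ (X = 1 ∧ ¬I)) + P(O(0,{≥2}))·P(X ≤ 1 ∧ ¬I) + P(O(1,{0}))·P(X = 0) + P(O(1,{≥1}))·P(X = 0 ∧ ¬I)`.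
[this work] -/
theorem real_card_le_one_inter_one_eq (v : Sym2 (Fin n) → unitInterval) {c c' : Fin n}
    (hcc' : (c = c₁ ∧ c' = c₂) ∨ (c = c₂ ∧ c' = c₁)) (ho : o ∉ Z)
    (hv : ∀ x y : Fin n, x ≠ y → x ∈ Z → y ∉ Z → y ≠ c₁ → y ≠ c₂ → (v s(x, y) : ℝ) = 0) (A : Finset (Fin n)) :
    (prodBernoulli v).real ({ω : BondConfig (Fin n) | (A.filter fun x => ω ∈ openConn o x).card ≤ 1} ∩
        {ω | offZ Z ω ∈ openConn o c ∧ offZ Z ω ∉ openConn o c'}) =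
      (prodBernoulli v).real {ω | (offZ Z ω ∈ openConn o c ∧ offZ Z ω ∉ openConn o c') ∧
          ((A \ Z).filter fun x => offZ Z ω ∈ openConn o x).card = 0 ∧
          ((A \ Z).filter fun x => offZ Z ω ∉ openConn o x ∧ offZ Z ω ∈ openConn c' x).card = 0} *
        (prodBernoulli v).real {ω | ((A ∩ Z).filter fun a => onZ Z ω ∈ openConn c a).card ≤ 1} +
      (prodBernoulli v).real {ω | (offZ Z ω ∈ openConn o c ∧ offZ Z ω ∉ openConn o c') ∧
          ((A \ Z).filter fun x => offZ Z ω ∈ openConn o x).card = 0 ∧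
          ((A \ Z).filter fun x => offZ Z ω ∉ openConn o x ∧ offZ Z ω ∈ openConn c' x).card = 1} *
        (prodBernoulli v).real {ω | ((A ∩ Z).filter fun a => onZ Z ω ∈ openConn c a).card = 0 ∨
          (((A ∩ Z).filter fun a => onZ Z ω ∈ openConn c a).card = 1 ∧ onZ Z ω ∉ openConn c₁ c₂)} +
      (prodBernoulli v).real {ω | (offZ Z ω ∈ openConn o c ∧ offZ Z ω ∉ openConn o c') ∧
          ((A \ Z).filter fun x => offZ Z ω ∈ openConn o x).card = 0 ∧
          2 ≤ ((A \ Z).filter fun x => offZ Z ω ∉ openConn o x ∧ offZ Z ω ∈ openConn c' x).card} *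
        (prodBernoulli v).real {ω | ((A ∩ Z).filter fun a => onZ Z ω ∈ openConn c a).card ≤ 1 ∧ onZ Z ω ∉ openConn c₁ c₂} +
      (prodBernoulli v).real {ω | (offZ Z ω ∈ openConn o c ∧ offZ Z ω ∉ openConn o c') ∧
          ((A \ Z).filter fun x => offZ Z ω ∈ openConn o x).card = 1 ∧
          ((A \ Z).filter fun x => offZ Z ω ∉ openConn o x ∧ offZ Z ω ∈ openConn c' x).card = 0} *
        (prodBernoulli v).real {ω | ((A ∩ Z).filter fun a => onZ Z ω ∈ openConn c a).card = 0} +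
      (prodBernoulli v).real {ω | (offZ Z ω ∈ openConn o c ∧ offZ Z ω ∉ openConn o c') ∧
          ((A \ Z).filter fun x => offZ Z ω ∈ openConn o x).card = 1 ∧
          1 ≤ ((A \ Z).filter fun x => offZ Z ω ∉ openConn o x ∧ offZ Z ω ∈ openConn c' x).card} *
        (prodBernoulli v).real {ω | ((A ∩ Z).filter fun a => onZ Z ω ∈ openConn c a).card = 0 ∧ onZ Z ω ∉ openConn c₁ c₂} := by
  set μ := prodBernoulli v with hμ
  have hmeas : ∀ U : Set (BondConfig (Fin n)), MeasurableSet U := fun U => (Set.toFinite U).measurableSet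
  -- abbreviations for the outside reads
  set T : BondConfig (Fin n) → Prop := fun ω => offZ Z ω ∈ openConn o c ∧ offZ Z ω ∉ openConn o c' with hT
  set Kf : BondConfig (Fin n) → ℕ := fun ω => ((A \ Z).filter fun x => offZ Z ω ∈ openConn o x).card with hKf
  set Kp : BondConfig (Fin n) → ℕ := fun ω => ((A \ Z).filter fun x => offZ Z ω ∉ openConn o x ∧ offZ Z ω ∈ openConn c' x).card
    with hKp
  set X : BondConfig (Fin n) → ℕ := fun ω => ((A ∩ Z).filter fun a => onZ Z ω ∈ openConn c a).card with hX
  set I : BondConfig (Fin n) → Prop := fun ω => onZ Z ω ∈ openConn c₁ c₂ with hI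
  set O00 := {ω | T ω ∧ Kf ω = 0 ∧ Kp ω = 0} with hO00
  set O01 := {ω | T ω ∧ Kf ω = 0 ∧ Kp ω = 1} with hO01
  set O02 := {ω | T ω ∧ Kf ω = 0 ∧ 2 ≤ Kp ω} with hO02
  set O10 := {ω | T ω ∧ Kf ω = 1 ∧ Kp ω = 0} with hO10
  set O11 := {ω | T ω ∧ Kf ω = 1 ∧ 1 ≤ Kp ω} with hO11
  set Y00 := {ω | X ω ≤ 1} with hY00
  set Y01 := {ω | X ω = 0 ∨ (X ω = 1 ∧ ¬ I ω)} with hY01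
  set Y02 := {ω | X ω ≤ 1 ∧ ¬ I ω} with hY02
  set Y10 := {ω | X ω = 0} with hY10
  set Y11 := {ω | X ω = 0 ∧ ¬ I ω} with hY11
  set S := {ω : BondConfig (Fin n) | (A.filter fun x => ω ∈ openConn o x).card ≤ 1} ∩ {ω | T ω} with hS
  set U := O00 ∩ Y00 ∪ O01 ∩ Y01 ∪ O02 ∩ Y02 ∪ O10 ∩ Y10 ∪ O11 ∩ Y11 with hU
  -- the one-gate count identity, `c`-side
  have hin : ∀ ω : BondConfig (Fin n), (∀ x y : Fin n, x ≠ y → s(x, y) ∈ ω → x ∈ Z → y ∉ Z → y = c₁ ∨ y = c₂) → T ω →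
      ((A ∩ Z).filter fun a => ω ∈ openConn o a).card = X ω := by
    intro ω hω hTω
    rcases hcc' with ⟨rfl, rfl⟩ | ⟨rfl, rfl⟩
    · exact congrArg _ (filter_congr fun a ha => reach_in₂_iff_of_one hω ho hTω.1 hTω.2 (mem_inter.1 ha).2)
    · exact congrArg _ (filter_congr fun a ha => reach_in₂_iff_of_two hω ho hTω.2 hTω.1 (mem_inter.1 ha).2)
  have hcount : ∀ ω : BondConfig (Fin n), (∀ x y : Fin n, x ≠ y → s(x, y) ∈ ω → x ∈ Z → y ∉ Z → y = c₁ ∨ y = c₂) → T ω →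
      (A.filter fun x => ω ∈ openConn o x).card = Kf ω + (if I ω then Kp ω else 0) + X ω := by
    intro ω hω hTω
    rw [card_filter_eq_sdiff_add_inter (Z := Z), card_filter_sdiff_eq₂_of_one hcc' hω ho hTω.1 hTω.2, hin ω hω hTω]
  have hST : μ.real S = μ.real U := by
    refine real_congr_of_twoTerminal (c₁ := c₁) (c₂ := c₂) (Z := Z) v hv _ _ fun ω hω => ?_
    simp only [hS, hU, hO00, hO01, hO02, hO10, hO11, hY00, hY01, hY02, hY10, hY11, Set.mem_inter_iff, Set.mem_union, mem_setOf_eq]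
    constructor
    · rintro ⟨hN, hTω⟩
      rw [hcount ω hω hTω] at hN
      by_cases hIω : I ω
      · rw [if_pos hIω] at hN
        by_cases hf : Kf ω = 0
        · by_cases hp : Kp ω = 0
          · exact Or.inl (Or.inl (Or.inl (Or.inl ⟨⟨hTω, hf, hp⟩, by omega⟩)))
          · exact Or.inl (Or.inl (Or.inl (Or.inr ⟨⟨hTω, hf, by omega⟩, Or.inl (by omega)⟩)))
        · exact Or.inl (Or.inr ⟨⟨hTω, by omega, by omega⟩, by omega⟩)
      · rw [if_neg hIω] at hN
        by_cases hf : Kf ω = 0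
        · by_cases hp : Kp ω = 0
          · exact Or.inl (Or.inl (Or.inl (Or.inl ⟨⟨hTω, hf, hp⟩, by omega⟩)))
          · by_cases hp1 : Kp ω = 1
            · exact Or.inl (Or.inl (Or.inl (Or.inr ⟨⟨hTω, hf, hp1⟩, by
                by_cases hx : X ω = 0
                · exact Or.inl hx
                · exact Or.inr ⟨by omega, hIω⟩⟩)))
            · exact Or.inl (Or.inl (Or.inr ⟨⟨hTω, hf, by omega⟩, by omega, hIω⟩))
        · by_cases hp : Kp ω = 0
          · exact Or.inl (Or.inr ⟨⟨hTω, by omega, hp⟩, by omega⟩)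
          · exact Or.inr ⟨⟨hTω, by omega, by omega⟩, by omega, hIω⟩
    · intro h
      have hTω : T ω := by
        rcases h with ((((⟨⟨hTω, -⟩, -⟩ | ⟨⟨hTω, -⟩, -⟩) | ⟨⟨hTω, -⟩, -⟩) | ⟨⟨hTω, -⟩, -⟩) | ⟨⟨hTω, -⟩, -⟩) <;> exact hTω
      refine ⟨?_, hTω⟩
      rw [hcount ω hω hTω]
      rcases h with ((((⟨⟨-, hf, hp⟩, hy⟩ | ⟨⟨-, hf, hp⟩, hy⟩) | ⟨⟨-, hf, hp⟩, hy, hI'⟩) | ⟨⟨-, hf, hp⟩, hy⟩) | ⟨⟨-, hf, hp⟩, hy, hI'⟩)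
      · by_cases hIω : I ω
        · rw [if_pos hIω]; omega
        · rw [if_neg hIω]; omega
      · rcases hy with hy | ⟨hy, hI'⟩
        · by_cases hIω : I ω
          · rw [if_pos hIω]; omega
          · rw [if_neg hIω]; omega
        · rw [if_neg hI']; omega
      · rw [if_neg hI']; omega
      · by_cases hIω : I ω
        · rw [if_pos hIω]; omega
        · rw [if_neg hIω]; omega
      · rw [if_neg hI']; omega
  -- pairwise disjointness (the outside cells are disjoint)
  have hd1 : Disjoint (O00 ∩ Y00) (O01 ∩ Y01) := by
    rw [Set.disjoint_left]; rintro ω ⟨⟨-, -, h⟩, -⟩ ⟨⟨-, -, h'⟩, -⟩; omega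
  have hd2 : Disjoint (O00 ∩ Y00 ∪ O01 ∩ Y01) (O02 ∩ Y02) := by
    rw [Set.disjoint_left]; rintro ω (⟨⟨-, -, h⟩, -⟩ | ⟨⟨-, -, h⟩, -⟩) ⟨⟨-, -, h'⟩, -⟩ <;> omega
  have hd3 : Disjoint (O00 ∩ Y00 ∪ O01 ∩ Y01 ∪ O02 ∩ Y02) (O10 ∩ Y10) := by
    rw [Set.disjoint_left]; rintro ω ((⟨⟨-, h, -⟩, -⟩ | ⟨⟨-, h, -⟩, -⟩) | ⟨⟨-, h, -⟩, -⟩) ⟨⟨-, h', -⟩, -⟩ <;> omega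
  have hd4 : Disjoint (O00 ∩ Y00 ∪ O01 ∩ Y01 ∪ O02 ∩ Y02 ∪ O10 ∩ Y10) (O11 ∩ Y11) := by
    rw [Set.disjoint_left]
    rintro ω (((⟨⟨-, h, -⟩, -⟩ | ⟨⟨-, h, -⟩, -⟩) | ⟨⟨-, h, -⟩, -⟩) | ⟨⟨-, -, h⟩, -⟩) ⟨⟨-, h', h''⟩, -⟩ <;> omega
  have hUsum : μ.real U = μ.real (O00 ∩ Y00) + μ.real (O01 ∩ Y01) + μ.real (O02 ∩ Y02) + μ.real (O10 ∩ Y10) + μ.real (O11 ∩ Y11) := by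
    rw [hU, measureReal_union hd4 (hmeas _), measureReal_union hd3 (hmeas _), measureReal_union hd2 (hmeas _),
      measureReal_union hd1 (hmeas _)]
  -- determinacy
  have hdO : ∀ (P : ℕ → ℕ → Prop), DeterminedBy {ω | T ω ∧ P (Kf ω) (Kp ω)} (↑(avoid Z) : Set (Sym2 (Fin n))) := fun P =>
    determinedBy_offZ Z fun η => (η ∈ openConn o c ∧ η ∉ openConn o c') ∧
      P ((A \ Z).filter fun x => η ∈ openConn o x).card ((A \ Z).filter fun x => η ∉ openConn o x ∧ η ∈ openConn c' x).card
  have hdY : ∀ (P : ℕ → Prop → Prop), DeterminedBy {ω | P (X ω) (I ω)} (↑(avoid Z) : Set (Sym2 (Fin n)))ᶜ := fun P =>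
    determinedBy_onZ Z fun η => P ((A ∩ Z).filter fun a => η ∈ openConn c a).card (η ∈ openConn c₁ c₂)
  have e00 : μ.real (O00 ∩ Y00) = μ.real O00 * μ.real Y00 :=
    prodBernoulli_real_inter_of_determinedBy v (avoid Z) (hdO fun k p => k = 0 ∧ p = 0) (hdY fun x _ => x ≤ 1) (hmeas _) (hmeas _)
  have e01 : μ.real (O01 ∩ Y01) = μ.real O01 * μ.real Y01 :=
    prodBernoulli_real_inter_of_determinedBy v (avoid Z) (hdO fun k p => k = 0 ∧ p = 1) (hdY fun x i => x = 0 ∨ (x = 1 ∧ ¬ i))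
      (hmeas _) (hmeas _)
  have e02 : μ.real (O02 ∩ Y02) = μ.real O02 * μ.real Y02 :=
    prodBernoulli_real_inter_of_determinedBy v (avoid Z) (hdO fun k p => k = 0 ∧ 2 ≤ p) (hdY fun x i => x ≤ 1 ∧ ¬ i) (hmeas _) (hmeas _)
  have e10 : μ.real (O10 ∩ Y10) = μ.real O10 * μ.real Y10 :=
    prodBernoulli_real_inter_of_determinedBy v (avoid Z) (hdO fun k p => k = 1 ∧ p = 0) (hdY fun x _ => x = 0) (hmeas _) (hmeas _)
  have e11 : μ.real (O11 ∩ Y11) = μ.real O11 * μ.real Y11 :=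
    prodBernoulli_real_inter_of_determinedBy v (avoid Z) (hdO fun k p => k = 1 ∧ 1 ≤ p) (hdY fun x i => x = 0 ∧ ¬ i) (hmeas _) (hmeas _)
  rw [hST, hUsum, e00, e01, e02, e10, e11]

/-- **The four outside types partition the space**: for any event `S`,
`P(S) = P(S, no gate) + P(S, gate c₁ only) + P(S, gate c₂ only) + P(S, both gates)` (gates `G_i = {o ~ c_i off Z}`).  With `S = {N ≤ 1}` the four terms
are `real_card_le_one_inter_none_eq`, `real_card_le_one_inter_one_eq` (at `(c, c') = (c₁, c₂)` and `(c₂, c₁)`) and `real_card_le_one_inter_both_eq`: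
together, the two-terminal decomposition `P(N ≤ 1) = Σ (outside cell) × (inside event)`. [this work] -/
theorem real_eq_sum_types₂ (μ : Measure (BondConfig (Fin n))) [IsFiniteMeasure μ] (S : Set (BondConfig (Fin n))) :
    μ.real S = μ.real (S ∩ {ω | offZ Z ω ∉ openConn o c₁ ∧ offZ Z ω ∉ openConn o c₂}) +
      μ.real (S ∩ {ω | offZ Z ω ∈ openConn o c₁ ∧ offZ Z ω ∉ openConn o c₂}) +
      μ.real (S ∩ {ω | offZ Z ω ∈ openConn o c₂ ∧ offZ Z ω ∉ openConn o c₁}) +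
      μ.real (S ∩ {ω | offZ Z ω ∈ openConn o c₁ ∧ offZ Z ω ∈ openConn o c₂}) := by
  have hmeas : ∀ U : Set (BondConfig (Fin n)), MeasurableSet U := fun U => (Set.toFinite U).measurableSet
  set T0 := S ∩ {ω | offZ Z ω ∉ openConn o c₁ ∧ offZ Z ω ∉ openConn o c₂} with hT0
  set T1 := S ∩ {ω | offZ Z ω ∈ openConn o c₁ ∧ offZ Z ω ∉ openConn o c₂} with hT1
  set T2 := S ∩ {ω | offZ Z ω ∈ openConn o c₂ ∧ offZ Z ω ∉ openConn o c₁} with hT2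
  set T12 := S ∩ {ω | offZ Z ω ∈ openConn o c₁ ∧ offZ Z ω ∈ openConn o c₂} with hT12
  have hS : S = T0 ∪ T1 ∪ T2 ∪ T12 := by
    ext ω
    simp only [hT0, hT1, hT2, hT12, Set.mem_union, Set.mem_inter_iff, mem_setOf_eq]
    by_cases h₁ : offZ Z ω ∈ openConn o c₁ <;> by_cases h₂ : offZ Z ω ∈ openConn o c₂ <;> simp [h₁, h₂]
  have hd1 : Disjoint T0 T1 := by
    rw [Set.disjoint_left]; rintro ω ⟨-, h, -⟩ ⟨-, h', -⟩; exact h h'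
  have hd2 : Disjoint (T0 ∪ T1) T2 := by
    rw [Set.disjoint_left]; rintro ω (⟨-, -, h⟩ | ⟨-, -, h⟩) ⟨-, h', -⟩ <;> exact h h'
  have hd3 : Disjoint (T0 ∪ T1 ∪ T2) T12 := by
    rw [Set.disjoint_left]; rintro ω ((⟨-, h, -⟩ | ⟨-, -, h⟩) | ⟨-, -, h⟩) ⟨-, h₁, h₂⟩
    · exact h h₁
    · exact h h₂
    · exact h h₁
  conv_lhs => rw [hS]
  rw [measureReal_union hd3 (hmeas _), measureReal_union hd2 (hmeas _), measureReal_union hd1 (hmeas _)]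

end Law

end Block

end Quant

end Summit.CriticalPhenomena.PercolationContinuityZ3.Theorems
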